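import Literature.Analysis.FluidPDE.BoltzmannHierarchySeries
import HarnessLib

/-!
# The corrected named fact behind `IsMildBoltzmannHierarchySolutionOn.exists_hasSum_boltzmannDuhamelTerm`

Topic: Analysis / FluidPDE (hard-sphere kinetic theory; companion of
`Literature.Analysis.FluidPDE.BBGKYMarginals` and `…BoltzmannHierarchySeries`).

The named fact `Literature.Analysis.FluidPDE.IsMildBoltzmannHierarchySolutionOn.exists_hasSum_boltzmannDuhamelTerm`
(`BBGKYMarginals`; Lanford 1975, CIP 1994 Thm 4.4.1, GST 2013 Ch. 5) — *a jointly measurable mild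
solution of the Boltzmann hierarchy with Lanford-class bounds on `[0, T]` is, for short times, the
sum of its iterated Duhamel series* — is stated for an ARBITRARY geometry `G : Geometry d X`, i.e.
a bare translation action `G.translate : X → ℝ^d → X` with no measurability whatsoever, its
docstring arguing that at `ε = 0` the collision configurations do not involve `G.translate`. That
is true of the collision configurations but not of the Duhamel iterates `Q⁰_{s,s+n}(t) F(0)`,
which compose `F(0)` with free flights `S_{-(t-τ)}, S_{-τ}, …` of integrated duration: the
summation argument of every source (Lanford 1975; CIP 1994 §4.4 Steps 3–4; GST 2013 Ch. 5; BGSR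
2016 §4) substitutes the Duhamel formula of `F^{(s+1)}` into that of `F^{(s)}` and distributes the
collision operator `C⁰_{s,s+1}` and the time integral over the resulting sum — with Bochner /
interval integrals an honest integrability, hence measurability, statement for the `(ω, v)`- and
`τ`-integrands of each term, which requires the joint measurability of
`(t, x, v) ↦ G.translate x (t • v)`. All sources work on `ℝ^d`, `T^d` or domains of `ℝ^d`, where
translation is continuous, and the sibling fact `IsMildBBGKYSolutionOn.eq_sum_bbgkyDuhamelTerm` of
the same file carries exactly this hypothesis (`hG`). No source covers non-measurable translation
actions, for which the printed proof does not apply (the time integrands of the iterates need not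
be measurable, so the linearity of the junk-valued integrals fails).

This file records the CORRECTED statement as a named fact — the original plus the hypothesis `hG`
of its sibling, nothing else changed except that the index type `d` and the position space `X`,
section parameters of the original, are quantified inside the statement so that the fact is a
closed proposition (the unused dimension hypothesis `2 ≤ d` is kept for literal comparability) —
and DISCHARGES it by Lanford's summation theorem
`IsMildBoltzmannHierarchySolutionOn.hasSum_boltzmannDuhamelTerm` of `BoltzmannHierarchySeries`.

*Update (2026-08-15, verdict-driven clean-up of `BBGKYMarginals`).* The paragraph above describes
the original fact as it stood when this file was written. It has since been RESTATED IN PLACE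
(name kept) to carry the hypothesis `hG` as well, so that it is now, binder for binder, the
present closed fact at fixed `d`, `X`; its discharge
`IsMildBoltzmannHierarchySolutionOn.exists_hasSum_boltzmannDuhamelTerm_holds` is recorded at the
end of this file (it cannot live in `BBGKYMarginals.lean`, which the proof file
`BoltzmannHierarchySeries` imports).
Both concrete geometries satisfy `hG` (`Euclidean.measurable_geometry_translate`,
`Literature.MathematicalPhysics.KineticTheory.Torus.measurable_geometry_translate`); the torus
form is the inventory statement hilbert6.S07
(`Literature.MathematicalPhysics.KineticTheory.boltzmann_hierarchy_duhamel_series`).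

## References

* O. E. Lanford III, *Time evolution of large classical systems*, in: Dynamical Systems, Theory
  and Applications, Lecture Notes in Physics 38, Springer (1975) 1–111 (bib key `Lanford1975`).
* C. Cercignani, R. Illner, M. Pulvirenti, *The Mathematical Theory of Dilute Gases*, Springer
  (1994), §4.4 Thm 4.4.1, Steps 3–4, pp. 77–85 (bib key `CIP1994`).
* I. Gallagher, L. Saint-Raymond, B. Texier, *From Newton to Boltzmann* (2013), arXiv:1208.5753,
  Part II Ch. 5, Thm 7 (bib key `GST2013`).
-/

open MeasureTheory Set

namespace Literature.Analysis.FluidPDE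

noncomputable section

universe u v

/-- **Corrected form of the named fact
`IsMildBoltzmannHierarchySolutionOn.exists_hasSum_boltzmannDuhamelTerm`** (Lanford 1975; CIP 1994
Thm 4.4.1 Steps 3–4; GST 2013 Part II Ch. 5 Thm 7): for a finite index type `d`, a position space
`X` with a measurable structure and a geometry `G` on it whose translation map is jointly
measurable (`hG` — the added hypothesis, see the module docstring; it is the `hG` of
`IsMildBBGKYSolutionOn.eq_sum_bbgkyDuhamelTerm` and holds on `ℝ^d` and `T^d`), a mild solution `F`
of the Boltzmann hierarchy on `[0, T]`, `T > 0`, jointly measurable in `(t, Z_s)` with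
Lanford-class bounds `|F^{(s)}(t, Z_s)| ≤ C b^s e^{-β E(Z_s)}` on `[0, T]` (`β > 0`), is for short
times the sum of its iterated Duhamel series: there is `T' ∈ (0, T]` with
`F^{(s)}(t, Z_s) = ∑_{n ≥ 0} Q⁰_{s,s+n}(t) F(0) (Z_s)` (`HasSum`) for all `s`, `t ∈ [0, T']`, `Z_s`.
Apart from `hG` (and the quantification over `d`, `X` inside the statement, which the original
takes as section parameters) the statement is that of the original verbatim; the dimension
hypothesis `hd` is kept for literal comparability but is not needed. Discharged below.
[cite: CIP1994, §4.4 Thm 4.4.1, Steps 3–4, pp. 83–85] -/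
def IsMildBoltzmannHierarchySolutionOn.exists_hasSum_boltzmannDuhamelTerm_of_measurable : Prop :=
  ∀ {d : Type u} [Fintype d] {X : Type v} [MeasurableSpace X] (hd : 2 ≤ Fintype.card d)
    {T : ℝ} (hT : 0 < T) {G : Geometry d X}
    (hG : Measurable fun p : X × EuclideanSpace ℝ d => G.translate p.1 p.2)
    {F : (s : ℕ) → ℝ → Config s d X → ℝ} (hF : IsMildBoltzmannHierarchySolutionOn T G F)
    (hmeas : ∀ s, Measurable fun p : ℝ × Config s d X => F s p.1 p.2)
    (hbound : ∃ C b β : ℝ, 0 < β ∧ ∀ s, ∀ t ∈ Icc 0 T, ∀ Zs : Config s d X,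
      |F s t Zs| ≤ C * b ^ s * Real.exp (-β * configEnergy Zs)),
    ∃ T' ∈ Ioc 0 T, ∀ s, ∀ t ∈ Icc 0 T', ∀ Zs : Config s d X,
      HasSum (fun n => boltzmannDuhamelTerm G n s t (fun k => F k 0) Zs) (F s t Zs)

/-- **The corrected named fact holds**: Lanford's summation
`IsMildBoltzmannHierarchySolutionOn.hasSum_boltzmannDuhamelTerm` (proved in
`BoltzmannHierarchySeries` from the tree's hierarchy machinery: BGSR chain estimate, finite Duhamel
iteration with remainder, geometric series). [cite: CIP1994, §4.4 Thm 4.4.1, Steps 3–4, pp. 83–85] -/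
theorem IsMildBoltzmannHierarchySolutionOn.exists_hasSum_boltzmannDuhamelTerm_of_measurable_holds :
    IsMildBoltzmannHierarchySolutionOn.exists_hasSum_boltzmannDuhamelTerm_of_measurable.{u, v} := by
  intro d _ X _ _hd T hT G hG F hF hmeas hbound
  exact hF.hasSum_boltzmannDuhamelTerm hT hG hmeas hbound

section Parametrised

variable {d : Type*} [Fintype d] {X : Type*} [MeasurableSpace X]

/-- **Discharge of the (restated) named fact
`IsMildBoltzmannHierarchySolutionOn.exists_hasSum_boltzmannDuhamelTerm`** of `BBGKYMarginals`
(Lanford 1975; CIP 1994 §4.4 Thm 4.4.1, proof Steps 3–4; GST 2013 Part II Ch. 5 Thm 7): since its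
2026-08-15 restatement the fact carries the joint measurability `hG` of the translation map, and
is exactly Lanford's summation theorem
`IsMildBoltzmannHierarchySolutionOn.hasSum_boltzmannDuhamelTerm` of `BoltzmannHierarchySeries`
(the dimension hypothesis is not used). Stated here, downstream of the fact's file, because the
proof imports it. [cite: CIPDiluteGases1994, §4.4 Thm 4.4.1, proof Steps 3–4, pp. 83–85] -/
theorem IsMildBoltzmannHierarchySolutionOn.exists_hasSum_boltzmannDuhamelTerm_holds :
    IsMildBoltzmannHierarchySolutionOn.exists_hasSum_boltzmannDuhamelTerm (d := d) (X := X) := by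
  intro _hd T hT G hG F hF hmeas hbound
  exact hF.hasSum_boltzmannDuhamelTerm hT hG hmeas hbound

end Parametrised

end

end Literature.Analysis.FluidPDE
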